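import Literature.Geometry.Lorentzian.ObstructionFreeGluing

/-!
# `ParametricKerrBurial`, line `receding-annulus-universal-collar` — stub `stub_chargeBound` (CB)
# (crux item stmt-FinalStateConjecture-10052)

The registered stub `stub_chargeBound`, proved: for an admissible bump `η` there is a constant
`C_η > 0` such that the four η-averaged LINEAR charges `E, P_i, C_l, J_l` of Mao–Oh–Tao
(arXiv:2308.13031, §1.2, (1.3)–(1.7)) of a pair `(g, k)` on the unit annulus are bounded by
`C_η · s`, where `s` is the `C² × C¹` sup-deviation `DevLE g k 1 2 s` of `(g, k)` from `(δ, 0)` on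
the closed shell `{1 ≤ |x| ≤ 2}` and `g` is `C¹`.

Elementary real analysis: with `r = 1` the weight is `η(|x|)`, which vanishes off the open shell
`{1 < |x| < 2}` (`supp η ⊆ [1, 2]`); on the shell `DevLE` bounds `|g_{ij} − δ_{ij}|`, `|∂_l g_{ij}|`,
`|k_{ij}|` by `s` (evaluate the operator norms on the unit vectors `e_i`), and the polynomial
weights `x^j/|x|`, `x^l`, `Y_l^i = (e_l × x)^i` are bounded by `1`, `2`, `4`.  Hence every integrand
is pointwise `≤ |η(|x|)| · K · s` with an absolute `K ≤ 200`, and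
`‖∫ f‖ ≤ ∫ bound` (`MeasureTheory.norm_integral_le_of_norm_le`, no integrability of `f` needed)
gives the claim with `C_η = 200 ∫ |η(|x|)| dx + 1`.

References: Mao–Oh–Tao 2023, §1.2 (the charges are linear functionals of `(g − δ, k)`).
-/

-- the doubled `FinalStateConjecture` path component is the summit/problem naming scheme, not a mistake
set_option linter.dupNamespace false
-- the operator norm on `E3 [×m]→L[ℝ] (E3 →L[ℝ] E3 →L[ℝ] ℝ)` needs a longer instance search than the default budget
set_option synthInstance.maxHeartbeats 120000
-- instance problems on the nested operator type `E3 →L[ℝ] E3 →L[ℝ] ℝ` need one more level of pending synthesis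
set_option maxSynthPendingDepth 2

noncomputable section

namespace Summit.FinalStateConjecture.FinalStateConjecture.Theorems.SwallowTheDatum.ParametricKerrBurial

open scoped ContDiff Topology BigOperators
open Set Filter Function Metric MeasureTheory Literature.Geometry.Lorentzian
open Literature.Geometry.Lorentzian.MaoOhTao

/-! ## §1 Elementary bounds: basis vectors, coordinates, finite sums -/

/-- The components of the standard basis vectors of `ℝ³` are bounded by `1`. [folklore] -/
theorem cb_abs_e_apply_le (l m : Fin 3) : |e l m| ≤ 1 := by
  simp only [e, PiLp.single_apply]
  split_ifs <;> norm_num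

/-- On `{|x| ≤ 2}` every Cartesian coordinate is bounded by `2`. [folklore] -/
theorem cb_abs_coord_le_two {x : E3} (hx : ‖x‖ ≤ 2) (j : Fin 3) : |x j| ≤ 2 :=
  ((Real.norm_eq_abs _).symm.trans_le (PiLp.norm_apply_le x j)).trans hx

/-- The radial direction cosines `x^j/|x|` are bounded by `1` (also at the origin, where they are
junk `0`). [folklore] -/
theorem cb_abs_coord_div_norm_le_one (x : E3) (j : Fin 3) : |x j / ‖x‖| ≤ 1 := by
  rw [abs_div, abs_norm]
  rcases eq_or_lt_of_le (norm_nonneg x) with h | h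
  · rw [← h, div_zero]
    exact zero_le_one
  · rw [div_le_one h, ← Real.norm_eq_abs]
    exact PiLp.norm_apply_le x j

/-- The components of the rotation generators `Y_l = e_l × x` are bounded by `4` on `{|x| ≤ 2}`.
[folklore] -/
theorem cb_abs_rotGen_le (l i : Fin 3) {x : E3} (hx : ‖x‖ ≤ 2) : |rotGen l x i| ≤ 4 := by
  have key : ∀ a b c d : Fin 3, |e l a * x b - e l c * x d| ≤ 4 := by
    intro a b c d
    calc |e l a * x b - e l c * x d| ≤ |e l a * x b| + |e l c * x d| := abs_sub _ _
      _ = |e l a| * |x b| + |e l c| * |x d| := by rw [abs_mul, abs_mul]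
      _ ≤ 1 * 2 + 1 * 2 :=
          add_le_add
            (mul_le_mul (cb_abs_e_apply_le l a) (cb_abs_coord_le_two hx b) (abs_nonneg _)
              zero_le_one)
            (mul_le_mul (cb_abs_e_apply_le l c) (cb_abs_coord_le_two hx d) (abs_nonneg _)
              zero_le_one)
      _ = 4 := by norm_num
  fin_cases i
  · exact key 1 2 2 1
  · exact key 2 0 0 2
  · exact key 0 1 1 0

/-- A factor bounded by `A` times a direction cosine `x^j/|x|` is bounded by `A`. [folklore] -/
theorem cb_abs_mul_dir_le {a A : ℝ} (ha : |a| ≤ A) (x : E3) (j : Fin 3) :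
    |a * (x j / ‖x‖)| ≤ A := by
  rw [abs_mul]
  calc |a| * |x j / ‖x‖| ≤ A * 1 :=
        mul_le_mul ha (cb_abs_coord_div_norm_le_one x j) (abs_nonneg _) ((abs_nonneg _).trans ha)
    _ = A := mul_one A

/-- A coordinate `x^l`, `|x| ≤ 2`, times a factor bounded by `A` is bounded by `2A`. [folklore] -/
theorem cb_abs_coord_mul_le {x : E3} (hx : ‖x‖ ≤ 2) (l : Fin 3) {a A : ℝ} (ha : |a| ≤ A) :
    |x l * a| ≤ 2 * A := by
  rw [abs_mul]
  exact mul_le_mul (cb_abs_coord_le_two hx l) ha (abs_nonneg _) zero_le_two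

/-- A factor bounded by `A` times a component of `Y_l = e_l × x`, `|x| ≤ 2`, is bounded by `4A`.
[folklore] -/
theorem cb_abs_mul_rotGen_le {a A : ℝ} (ha : |a| ≤ A) (l i : Fin 3) {x : E3} (hx : ‖x‖ ≤ 2) :
    |a * rotGen l x i| ≤ A * 4 := by
  rw [abs_mul]
  exact mul_le_mul ha (cb_abs_rotGen_le l i hx) (abs_nonneg _) ((abs_nonneg _).trans ha)

/-- `|Σ_{j<3} f j| ≤ 3c` when every `|f j| ≤ c`. [folklore] -/
theorem cb_abs_sum3_le {f : Fin 3 → ℝ} {c : ℝ} (h : ∀ j, |f j| ≤ c) : |∑ j, f j| ≤ 3 * c :=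
  calc |∑ j, f j| ≤ ∑ j, |f j| := Finset.abs_sum_le_sum_abs _ _
    _ ≤ ∑ _j : Fin 3, c := Finset.sum_le_sum fun j _ ↦ h j
    _ = 3 * c := by simp

/-- `|Σ_{i,j<3} f i j| ≤ 9c` when every `|f i j| ≤ c`. [folklore] -/
theorem cb_abs_sum33_le {f : Fin 3 → Fin 3 → ℝ} {c : ℝ} (h : ∀ i j, |f i j| ≤ c) :
    |∑ i, ∑ j, f i j| ≤ 9 * c :=
  calc |∑ i, ∑ j, f i j| ≤ 3 * (3 * c) := cb_abs_sum3_le fun i ↦ cb_abs_sum3_le (h i)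
    _ = 9 * c := by ring

/-- `|a − b| ≤ A + B` from `|a| ≤ A`, `|b| ≤ B`. [folklore] -/
theorem cb_abs_sub_le {a b A B : ℝ} (ha : |a| ≤ A) (hb : |b| ≤ B) : |a - b| ≤ A + B :=
  (abs_sub a b).trans (add_le_add ha hb)

/-- `|a + b| ≤ A + B` from `|a| ≤ A`, `|b| ≤ B`. [folklore] -/
theorem cb_abs_add_le {a b A B : ℝ} (ha : |a| ≤ A) (hb : |b| ≤ B) : |a + b| ≤ A + B :=
  (abs_add_le a b).trans (add_le_add ha hb)

/-! ## §2 The deviation bounds on the shell -/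

/-- A bilinear form evaluated on two basis vectors is bounded by its operator norm. [folklore] -/
theorem cb_abs_apply₂_le_norm (B : E3 →L[ℝ] E3 →L[ℝ] ℝ) (i j : Fin 3) : |B (e i) (e j)| ≤ ‖B‖ := by
  have h := B.le_opNorm₂ (e i) (e j)
  have he : ∀ m : Fin 3, ‖e m‖ = 1 := fun m ↦ by simp [e]
  rwa [he, he, mul_one, mul_one, Real.norm_eq_abs] at h

/-- The components of `g − δ`: `(g(x) − δ)(e_i, e_j) = g_{ij}(x) − δ_{ij}`. [folklore] -/
theorem cb_sub_innerSL_apply (g : E3 → E3 →L[ℝ] E3 →L[ℝ] ℝ) (i j : Fin 3) (x : E3) :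
    (g x - (innerSL ℝ : E3 →L[ℝ] E3 →L[ℝ] ℝ)) (e i) (e j) =
      MaoOhTao.cmp g i j x - (if i = j then 1 else 0) := by
  have hin : (innerSL ℝ : E3 →L[ℝ] E3 →L[ℝ] ℝ) (e i) (e j) = if i = j then 1 else 0 := by
    show inner ℝ (e i) (e j) = _
    simp [e, EuclideanSpace.inner_single_left]
  rw [sub_apply, sub_apply, hin]
  rfl

/-- The coordinate derivative of a component of a `C¹` field of bilinear forms is the component of
the Fréchet derivative: `∂_l g_{ij}(x) = (Dg(x) e_l)(e_i, e_j)`. [folklore] -/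
theorem cb_pd_cmp {g : E3 → E3 →L[ℝ] E3 →L[ℝ] ℝ} (hg : ContDiff ℝ 1 g) (l i j : Fin 3) (x : E3) :
    pd l (MaoOhTao.cmp g i j) x = fderiv ℝ g x (e l) (e i) (e j) := by
  obtain ⟨A, hA⟩ : ∃ A : (E3 →L[ℝ] E3 →L[ℝ] ℝ) →L[ℝ] ℝ, ∀ B, A B = B (e i) (e j) :=
    ⟨(ContinuousLinearMap.apply ℝ ℝ (e j)).comp (ContinuousLinearMap.apply ℝ (E3 →L[ℝ] ℝ) (e i)),
      fun B ↦ rfl⟩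
  have hcmp : MaoOhTao.cmp g i j = ⇑A ∘ g := funext fun y ↦ (hA (g y)).symm
  have hd : HasFDerivAt (⇑A ∘ g) (A.comp (fderiv ℝ g x)) x :=
    A.hasFDerivAt.comp x ((hg.differentiable one_ne_zero) x).hasFDerivAt
  rw [pd, hcmp, hd.fderiv, ContinuousLinearMap.comp_apply, hA]

/-- **On-shell consequences of `DevLE g k 1 2 s`** at a point `x` of the closed shell `{1 ≤ |x| ≤ 2}`
(with `g ∈ C¹`): `|g_{ij} − δ_{ij}| ≤ s`, `|∂_l g_{ij}| ≤ s`, `|k_{ij}| ≤ s`, `|tr_δ k| ≤ 3s`. [folklore] -/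
theorem cb_shell_bounds {g k : E3 → E3 →L[ℝ] E3 →L[ℝ] ℝ} {s : ℝ} (hg : ContDiff ℝ 1 g)
    (hdev : DevLE g k 1 2 s) {x : E3} (h1 : 1 ≤ ‖x‖) (h2 : ‖x‖ ≤ 2) :
    (∀ i j, |MaoOhTao.cmp g i j x - (if i = j then 1 else 0)| ≤ s) ∧
      (∀ l i j, |pd l (MaoOhTao.cmp g i j) x| ≤ s) ∧
      (∀ i j, |MaoOhTao.cmp k i j x| ≤ s) ∧ |trδ k x| ≤ 3 * s := by
  obtain ⟨hG, hK⟩ := hdev x h1 h2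
  have h0 : ‖g x - (innerSL ℝ : E3 →L[ℝ] E3 →L[ℝ] ℝ)‖ ≤ s := by
    have h := hG 0 (by norm_num)
    rwa [norm_iteratedFDeriv_zero] at h
  have h1' : ‖fderiv ℝ g x‖ ≤ s := by
    have h := hG 1 (by norm_num)
    rwa [norm_iteratedFDeriv_one, fderiv_sub_const] at h
  have hk0 : ‖k x‖ ≤ s := by
    have h := hK 0 (by norm_num)
    rwa [norm_iteratedFDeriv_zero] at h
  have hkc : ∀ i j, |MaoOhTao.cmp k i j x| ≤ s := fun i j ↦ (cb_abs_apply₂_le_norm (k x) i j).trans hk0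
  refine ⟨fun i j ↦ ?_, fun l i j ↦ ?_, hkc, ?_⟩
  · rw [← cb_sub_innerSL_apply]
    exact (cb_abs_apply₂_le_norm _ i j).trans h0
  · rw [cb_pd_cmp hg]
    calc |fderiv ℝ g x (e l) (e i) (e j)| ≤ ‖fderiv ℝ g x (e l)‖ := cb_abs_apply₂_le_norm _ i j
      _ ≤ ‖fderiv ℝ g x‖ * ‖e l‖ := ContinuousLinearMap.le_opNorm _ _
      _ ≤ s := by rw [show ‖e l‖ = 1 by simp [e], mul_one]; exact h1'
  · exact cb_abs_sum3_le fun i ↦ hkc i i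

/-! ## §3 The weight and the integral estimate -/

/-- The unit-scale weight is `η(|x|)`. [cite: MaoOhTao2023, §1.2 (1.7)] -/
theorem cb_wt_one (η : ℝ → ℝ) (x : E3) : wt η 1 x = η ‖x‖ := by
  simp [wt]

/-- A bump is nonzero only on the open shell `(1, 2)`. [cite: MaoOhTao2023, §1.2] -/
theorem cb_shell_of_ne {η : ℝ → ℝ} (hη : IsBump η) {r : ℝ} (hr : η r ≠ 0) : 1 < r ∧ r < 2 := by
  obtain ⟨-, hlo, hhi, -⟩ := hη
  exact ⟨not_le.mp fun h ↦ hr (hlo r h), not_le.mp fun h ↦ hr (hhi r h)⟩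

/-- **The integral estimate**: if `|F(x)| ≤ |η(|x|)| · B` pointwise then `|∫ F| ≤ (∫ |η(|x|)| dx) · B`
(the bound is continuous with support in the closed ball of radius `2`, hence integrable; no
integrability of `F` is needed, `MeasureTheory.norm_integral_le_of_norm_le`). [folklore] -/
theorem cb_abs_integral_le {η : ℝ → ℝ} (hη : IsBump η) {F : E3 → ℝ} {B : ℝ}
    (h : ∀ x, |F x| ≤ |η ‖x‖| * B) : |∫ x, F x| ≤ (∫ x : E3, |η ‖x‖|) * B := by
  obtain ⟨hsm, -, hhi, -⟩ := hη
  have hηc : Continuous η := hsm.continuous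
  have hcont : Continuous fun x : E3 ↦ |η ‖x‖| * B :=
    ((hηc.comp continuous_norm).abs).mul continuous_const
  have hsupp : HasCompactSupport fun x : E3 ↦ |η ‖x‖| * B := by
    refine HasCompactSupport.intro (isCompact_closedBall (0 : E3) 2) fun x hx ↦ ?_
    rw [mem_closedBall_zero_iff, not_le] at hx
    simp [hhi _ hx.le]
  have hint : Integrable (fun x : E3 ↦ |η ‖x‖| * B) := hcont.integrable_of_hasCompactSupport hsupp
  calc |∫ x, F x| = ‖∫ x, F x‖ := (Real.norm_eq_abs _).symm
    _ ≤ ∫ x : E3, |η ‖x‖| * B :=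
        norm_integral_le_of_norm_le hint (Eventually.of_forall fun x ↦ by
          rw [Real.norm_eq_abs]; exact h x)
    _ = (∫ x : E3, |η ‖x‖|) * B := integral_mul_const _ _

/-- The integral estimate with the prefactor `½` of `E` and `C`. [folklore] -/
theorem cb_abs_half_integral_le {η : ℝ → ℝ} (hη : IsBump η) {F : E3 → ℝ} {B : ℝ} (hB : 0 ≤ B)
    (h : ∀ x, |F x| ≤ |η ‖x‖| * B) : |1 / 2 * ∫ x, F x| ≤ (∫ x : E3, |η ‖x‖|) * B := by
  have h1 := cb_abs_integral_le hη h
  have h2 : 0 ≤ (∫ x : E3, |η ‖x‖|) * B := mul_nonneg (integral_nonneg fun x ↦ abs_nonneg _) hB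
  rw [abs_mul, abs_of_pos (by norm_num : (0 : ℝ) < 1 / 2)]
  linarith

/-! ## §4 The four charges -/

/-- **Energy**: `|E[(g,k); A_1]| ≤ 18 s ∫|η(|x|)|`. [cite: MaoOhTao2023, §1.2 (1.3)] -/
theorem cb_avgE_le {η : ℝ → ℝ} (hη : IsBump η) {g k : E3 → E3 →L[ℝ] E3 →L[ℝ] ℝ} {s : ℝ}
    (hg : ContDiff ℝ 1 g) (hs : 0 ≤ s) (hdev : DevLE g k 1 2 s) :
    |avgE η 1 g| ≤ (∫ x : E3, |η ‖x‖|) * (18 * s) := by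
  unfold avgE
  refine cb_abs_half_integral_le hη (by positivity) fun x ↦ ?_
  beta_reduce
  rw [cb_wt_one, abs_mul]
  by_cases hx : η ‖x‖ = 0
  · rw [hx, abs_zero, zero_mul, zero_mul]
  obtain ⟨h1, h2⟩ := cb_shell_of_ne hη hx
  obtain ⟨-, hpd, -, -⟩ := cb_shell_bounds hg hdev h1.le h2.le
  refine mul_le_mul_of_nonneg_left ?_ (abs_nonneg _)
  calc _ ≤ 9 * (2 * s) := cb_abs_sum33_le fun i j ↦ ?_
    _ = 18 * s := by ring
  calc _ ≤ s + s := cb_abs_mul_dir_le (cb_abs_sub_le (hpd i i j) (hpd j i i)) x j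
    _ = 2 * s := by ring

/-- **Linear momentum**: `|P_i[(g,k); A_1]| ≤ 12 s ∫|η(|x|)|`. [cite: MaoOhTao2023, §1.2 (1.4)] -/
theorem cb_avgP_le {η : ℝ → ℝ} (hη : IsBump η) {g k : E3 → E3 →L[ℝ] E3 →L[ℝ] ℝ} {s : ℝ}
    (hg : ContDiff ℝ 1 g) (hs : 0 ≤ s) (hdev : DevLE g k 1 2 s) (i : Fin 3) :
    |avgP η 1 k i| ≤ (∫ x : E3, |η ‖x‖|) * (12 * s) := by
  unfold avgP
  refine cb_abs_integral_le hη fun x ↦ ?_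
  beta_reduce
  rw [cb_wt_one, abs_mul]
  by_cases hx : η ‖x‖ = 0
  · rw [hx, abs_zero, zero_mul, zero_mul]
  obtain ⟨h1, h2⟩ := cb_shell_of_ne hη hx
  obtain ⟨-, -, hk, htr⟩ := cb_shell_bounds hg hdev h1.le h2.le
  refine mul_le_mul_of_nonneg_left ?_ (abs_nonneg _)
  calc _ ≤ 3 * (4 * s) := cb_abs_sum3_le fun j ↦ ?_
    _ = 12 * s := by ring
  have hif : |(if i = j then trδ k x else 0)| ≤ 3 * s := by
    by_cases hij : i = j
    · rw [if_pos hij]; exact htr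
    · rw [if_neg hij, abs_zero]; positivity
  calc _ ≤ s + 3 * s := cb_abs_mul_dir_le (cb_abs_sub_le (hk i j) hif) x j
    _ = 4 * s := by ring

/-- **Centre of mass**: `|C_l[(g,k); A_1]| ≤ 54 s ∫|η(|x|)|`. [cite: MaoOhTao2023, §1.2 (1.5)] -/
theorem cb_avgC_le {η : ℝ → ℝ} (hη : IsBump η) {g k : E3 → E3 →L[ℝ] E3 →L[ℝ] ℝ} {s : ℝ}
    (hg : ContDiff ℝ 1 g) (hs : 0 ≤ s) (hdev : DevLE g k 1 2 s) (l : Fin 3) :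
    |avgC η 1 g l| ≤ (∫ x : E3, |η ‖x‖|) * (54 * s) := by
  unfold avgC
  refine cb_abs_half_integral_le hη (by positivity) fun x ↦ ?_
  beta_reduce
  rw [cb_wt_one, abs_mul]
  by_cases hx : η ‖x‖ = 0
  · rw [hx, abs_zero, zero_mul, zero_mul]
  obtain ⟨h1, h2⟩ := cb_shell_of_ne hη hx
  obtain ⟨hc, hpd, -, -⟩ := cb_shell_bounds hg hdev h1.le h2.le
  refine mul_le_mul_of_nonneg_left ?_ (abs_nonneg _)
  calc _ ≤ 9 * (6 * s) := cb_abs_sum33_le fun i j ↦ ?_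
    _ = 54 * s := by ring
  have hA : |x l * pd i (MaoOhTao.cmp g i j) x| ≤ 2 * s := cb_abs_coord_mul_le h2.le l (hpd i i j)
  have hB : |x l * pd j (MaoOhTao.cmp g i i) x| ≤ 2 * s := cb_abs_coord_mul_le h2.le l (hpd j i i)
  have hC : |(if i = l then MaoOhTao.cmp g i j x - (if i = j then 1 else 0) else 0)| ≤ s := by
    by_cases hil : i = l
    · rw [if_pos hil]; exact hc i j
    · rw [if_neg hil, abs_zero]; exact hs
  have hD : |(if j = l then MaoOhTao.cmp g i i x - 1 else 0)| ≤ s := by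
    by_cases hjl : j = l
    · rw [if_pos hjl]; simpa using hc i i
    · rw [if_neg hjl, abs_zero]; exact hs
  calc _ ≤ 2 * s + 2 * s + s + s :=
        cb_abs_mul_dir_le (cb_abs_add_le (cb_abs_sub_le (cb_abs_sub_le hA hB) hC) hD) x j
    _ = 6 * s := by ring

/-- **Angular momentum**: `|J_l[(g,k); A_1]| ≤ 144 s ∫|η(|x|)|`. [cite: MaoOhTao2023, §1.2 (1.6)] -/
theorem cb_avgJ_le {η : ℝ → ℝ} (hη : IsBump η) {g k : E3 → E3 →L[ℝ] E3 →L[ℝ] ℝ} {s : ℝ}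
    (hg : ContDiff ℝ 1 g) (hs : 0 ≤ s) (hdev : DevLE g k 1 2 s) (l : Fin 3) :
    |avgJ η 1 k l| ≤ (∫ x : E3, |η ‖x‖|) * (144 * s) := by
  unfold avgJ
  refine cb_abs_integral_le hη fun x ↦ ?_
  beta_reduce
  rw [cb_wt_one, abs_mul]
  by_cases hx : η ‖x‖ = 0
  · rw [hx, abs_zero, zero_mul, zero_mul]
  obtain ⟨h1, h2⟩ := cb_shell_of_ne hη hx
  obtain ⟨-, -, hk, htr⟩ := cb_shell_bounds hg hdev h1.le h2.le
  refine mul_le_mul_of_nonneg_left ?_ (abs_nonneg _)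
  calc _ ≤ 9 * (16 * s) := cb_abs_sum33_le fun i j ↦ ?_
    _ = 144 * s := by ring
  have hif : |(if i = j then trδ k x else 0)| ≤ 3 * s := by
    by_cases hij : i = j
    · rw [if_pos hij]; exact htr
    · rw [if_neg hij, abs_zero]; positivity
  calc _ ≤ (s + 3 * s) * 4 :=
        cb_abs_mul_dir_le (cb_abs_mul_rotGen_le (cb_abs_sub_le (hk i j) hif) l i h2.le) x j
    _ = 16 * s := by ring

/-! ## §5 The registered stub -/

/-- **Stub CB — `stub_chargeBound`.** For every admissible bump `η` there is `C_η > 0` such that the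
η-averaged linear charges `E, P, C, J` on the unit annulus of a `C¹` metric field `g` and a field `k`
with `C² × C¹` sup-deviation `≤ s` from `(δ, 0)` on `{1 ≤ |x| ≤ 2}` are all bounded by `C_η s`
(here `C_η = 200 ∫ |η(|x|)| dx + 1`). Mao–Oh–Tao 2023, §1.2: the charges are linear functionals of
`(g − δ, k)` given by integrals of first derivatives / values against bounded weights supported in the
shell. [cite: MaoOhTao2023, §1.2] -/
theorem stub_chargeBound :
    ∀ η : ℝ → ℝ, IsBump η → ∃ Cη : ℝ, 0 < Cη ∧
      ∀ (g k : E3 → E3 →L[ℝ] E3 →L[ℝ] ℝ) (s : ℝ), ContDiff ℝ 1 g → 0 ≤ s → DevLE g k 1 2 s →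
        |avgE η 1 g| ≤ Cη * s ∧ (∀ i, |avgP η 1 k i| ≤ Cη * s) ∧
          (∀ i, |avgC η 1 g i| ≤ Cη * s) ∧ (∀ i, |avgJ η 1 k i| ≤ Cη * s) := by
  intro η hη
  obtain ⟨I, hI⟩ : ∃ I : ℝ, I = ∫ x : E3, |η ‖x‖| := ⟨_, rfl⟩
  have hI0 : 0 ≤ I := hI ▸ integral_nonneg fun x ↦ abs_nonneg _
  refine ⟨200 * I + 1, by positivity, fun g k s hg hs hdev ↦ ?_⟩
  have fin : ∀ {t K : ℝ}, K ≤ 200 → |t| ≤ (∫ x : E3, |η ‖x‖|) * (K * s) → |t| ≤ (200 * I + 1) * s := by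
    intro t K hK ht
    rw [← hI] at ht
    nlinarith [mul_nonneg (mul_nonneg hI0 hs) (sub_nonneg.2 hK)]
  exact ⟨fin (by norm_num) (cb_avgE_le hη hg hs hdev),
    fun i ↦ fin (by norm_num) (cb_avgP_le hη hg hs hdev i),
    fun l ↦ fin (by norm_num) (cb_avgC_le hη hg hs hdev l),
    fun l ↦ fin (by norm_num) (cb_avgJ_le hη hg hs hdev l)⟩

end Summit.FinalStateConjecture.FinalStateConjecture.Theorems.SwallowTheDatum.ParametricKerrBurial
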